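import Literature.Computability.ImplicitComplexity.STASubstData
import Literature.Computability.ImplicitComplexity.STAProperty1
import Literature.Computability.ImplicitComplexity.STAMergeCopies
import HarnessLib

/-!
# Substitution data above a multiplexor (case `(m)` of the substitution lemma)

Support file for the `PTIME` soundness half of `STACapturesP` (GMR08 Thm. 3.5). In the `(m)`
case of GR07's substitution lemma (GMR08 Lemma 3.4) the judgement
`Γ, x : !σ ⊢ M[x/x₁, …, x/xₙ] : μ` comes from `Γ, x₁ : σ, …, xₙ : σ ⊢ M : μ` (`n ≤ r`). Typed
substitution data for the conclusion is turned into data for the premise (`SubstData.expand`):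

* if `x` is merely RENAMED (to `x'`), the `xᵢ` are renamed to fresh distinct slots, and after
  the substitution one multiplexor contracts them into `x'` (`finish` clause);
* if `x` receives a term `N : !σ` with derivation `Σ`, then by Property 1 `Σ` is a box over
  `Γ' ⊢ N : σ` of weight `W(Σ)/r`; each `xᵢ` receives a copy of `N` with the variables of `Γ'`
  renamed apart into the block `m·(xᵢ+1) + ·` (`MTyping.rename_ctx`), of total cost
  `n · W(Σ)/r ≤ W(Σ)` (`cost` clause), and after the substitution the copies of every `y ∈ Γ'`
  are contracted back into `y : !(Γ' y)` (`MTyping.mergeCopies`), the remaining assumptions of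
  the context of `Σ` being restored by admissible weakening (`finish` clause).

## References

* [GaboardiMarionRonchidellarocca2008] GMR08, Table 2 (rule `(m)`), Property 1, §3.1
  (Lemma 3.4), Def. A.1.
* [GaboardiRonchiDellaRocca2007] GR07, §4 (Substitution Lemma, case `(m)`).
-/

namespace Literature.Computability.ImplicitComplexity

namespace STA

namespace SubstData

variable {r D : ℕ} {Θ₀ : Ctx} {S : Finset ℕ} {j : ℕ} {σ : SoftTy}
  {θ : ℕ → Term} {Δ : ℕ → Ctx} {cost : ℕ → ℕ}

/-- **Expanding substitution data above a multiplexor.** Typed substitution data out of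
`Θ₀.mpx S j σ` (the conclusion of an `(m)` contracting the slots `S`, all of type `σ` in `Θ₀`,
into the fresh slot `j`, `|S| ≤ r`) yields typed substitution data out of `Θ₀` of no larger
total cost, such that every judgement obtained by substituting the new data into a term `P₀`
over `Θ₀` yields, with the same measures, the judgement obtained by substituting the old data
into `P₀[x_j/S]`. [cite: GaboardiMarionRonchidellarocca2008, Lemma 3.4 (§3.1), Property 1, Table 2 (m)] -/
theorem expand (hSσ : ∀ i ∈ S, Θ₀ i = some σ) (hj : Θ₀ j = none) (hr : S.card ≤ r)
    (hS : SubstData r D (Θ₀.mpx S j σ) θ Δ cost) :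
    ∃ (θ₀ : ℕ → Term) (Δ₀ : ℕ → Ctx) (cost₀ : ℕ → ℕ), SubstData r D Θ₀ θ₀ Δ₀ cost₀ ∧
      (∀ n, (Θ₀.mpx S j σ).BoundedBy n → Θ₀.BoundedBy n →
        (Finset.range n).sum cost₀ ≤ (Finset.range n).sum cost) ∧
      (∀ (d' w' : ℕ) (P₀ : Term) (μ : SoftTy), (∀ i, P₀.FreeIn i → Θ₀ i ≠ none) →
        MTyping r w' d' (Ctx.iUnion Δ₀) (P₀.substp θ₀) μ →
        MTyping r w' d' (Ctx.iUnion Δ) ((P₀.rename (mpxRen S j)).substp θ) μ) := by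
  -- bookkeeping about the conclusion context `Θ = Θ₀.mpx S j σ`
  set Θ := Θ₀.mpx S j σ with hΘdef
  have hjS : j ∉ S := fun h => by rw [hSσ j h] at hj; cases hj
  have hΘj : Θ j = some σ.bang := by simp [hΘdef, Ctx.mpx, hjS]
  have hΘS : ∀ i ∈ S, Θ i = none := fun i hi => by simp [hΘdef, Ctx.mpx, hi]
  have hΘof : ∀ i, i ∉ S → i ≠ j → Θ i = Θ₀ i := fun i hi hij => by
    simp [hΘdef, Ctx.mpx, hi, hij]
  have hΔS : ∀ i ∈ S, ∀ i', Δ i i' = none := fun i hi => (hS.off i (hΘS i hi)).1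
  have hcostS : ∀ i ∈ S, cost i = 0 := fun i hi => hS.cost_eq_zero (hΘS i hi)
  have hfree₀ : ∀ i, Θ₀ i ≠ none → i ∉ S → Θ i = Θ₀ i ∧ i ≠ j := fun i hi hiS => by
    have hij : i ≠ j := fun e => by subst e; exact hi hj
    exact ⟨hΘof i hiS hij, hij⟩
  -- a bound `m > 0` on the supports of all pieces
  obtain ⟨m₀, hm₀⟩ := hS.bdd
  set m := m₀ + 1 with hmdef
  have hm : 0 < m := by omega
  have hΔm : ∀ i i', Δ i i' ≠ none → i' < m := fun i i' h => by
    by_contra hc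
    exact h (hm₀ i i' (by omega))
  -- the two cases for the contracted slot `j`
  rcases hS.slot j σ.bang hΘj with ⟨j', hθj, hsing, hcj⟩ | ⟨dj, hdj, hder⟩
  · ----------------------------------------------------------------
    -- Case R: `j` is renamed to `j'`; rename the slots of `S` to the fresh slots `m + i`
    ----------------------------------------------------------------
    have hj'm : j' < m := hΔm j j' (by rw [hsing.1]; simp)
    let θ₀ : ℕ → Term := fun i => if i ∈ S then .var (m + i) else θ i
    let Δ₀ : ℕ → Ctx := fun i =>
      if i ∈ S then (fun i' => if i' = m + i then some σ else none)
      else if i = j then Ctx.empty else Δ i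
    have hΔ₀S : ∀ i ∈ S, Δ₀ i = fun i' => if i' = m + i then some σ else none := fun i hi => by
      simp [Δ₀, hi]
    have hΔ₀j : Δ₀ j = Ctx.empty := by simp [Δ₀, hjS]
    have hΔ₀of : ∀ i, i ∉ S → i ≠ j → Δ₀ i = Δ i := fun i hi hij => by simp [Δ₀, hi, hij]
    have hθ₀S : ∀ i ∈ S, θ₀ i = .var (m + i) := fun i hi => by simp [θ₀, hi]
    have hθ₀of : ∀ i, i ∉ S → θ₀ i = θ i := fun i hi => by simp [θ₀, hi]
    -- supports of the new pieces
    have hsupp : ∀ i i', Δ₀ i i' ≠ none →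
        (i ∈ S ∧ i' = m + i) ∨ (i ∉ S ∧ i ≠ j ∧ Δ i i' ≠ none) := by
      intro i i' h
      by_cases hiS : i ∈ S
      · rw [hΔ₀S i hiS] at h
        by_cases he : i' = m + i
        · exact Or.inl ⟨hiS, he⟩
        · simp [he] at h
      · by_cases hij : i = j
        · subst hij; rw [hΔ₀j] at h; exact absurd rfl h
        · rw [hΔ₀of i hiS hij] at h
          exact Or.inr ⟨hiS, hij, h⟩
    have hSD : SubstData r D Θ₀ θ₀ Δ₀ cost := by
      refine ⟨fun i τ hτ => ?_, fun i hi => ?_, fun i₁ i₂ i' hne h₁ => ?_, ?_⟩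
      · by_cases hiS : i ∈ S
        · rw [hSσ i hiS] at hτ
          cases hτ
          refine Or.inl ⟨m + i, hθ₀S i hiS, ⟨by rw [hΔ₀S i hiS]; simp, fun k hk => ?_⟩,
            hcostS i hiS⟩
          rw [hΔ₀S i hiS]; simp [hk]
        · obtain ⟨hΘi, hij⟩ := hfree₀ i (by rw [hτ]; simp) hiS
          rw [hθ₀of i hiS, hΔ₀of i hiS hij]
          exact hS.slot i τ (by rw [hΘi, hτ])
      · have hiS : i ∉ S := fun h => by rw [hSσ i h] at hi; cases hi
        by_cases hij : i = j
        · subst hij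
          exact ⟨fun i' => by rw [hΔ₀j]; rfl, hcj⟩
        · rw [hΔ₀of i hiS hij]
          exact hS.off i (by rw [hΘof i hiS hij, hi])
      · rcases hsupp i₁ i' h₁ with ⟨h₁S, rfl⟩ | ⟨h₁S, h₁j, hΔ₁⟩
        · by_cases h₂S : i₂ ∈ S
          · rw [hΔ₀S i₂ h₂S]
            simp [hne]
          · by_cases h₂j : i₂ = j
            · subst h₂j; rw [hΔ₀j]; rfl
            · rw [hΔ₀of i₂ h₂S h₂j]
              exact hm₀ i₂ _ (by omega)
        · have hi'm := hΔm i₁ i' hΔ₁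
          by_cases h₂S : i₂ ∈ S
          · rw [hΔ₀S i₂ h₂S]
            have : i' ≠ m + i₂ := by omega
            simp [this]
          · by_cases h₂j : i₂ = j
            · subst h₂j; rw [hΔ₀j]; rfl
            · rw [hΔ₀of i₂ h₂S h₂j]
              exact hS.disj i₁ i₂ i' hne hΔ₁
      · refine ⟨m + S.sup id + 1, fun i i' hi' => ?_⟩
        by_contra h
        rcases hsupp i i' h with ⟨hiS, rfl⟩ | ⟨-, -, hΔi⟩
        · have : i ≤ S.sup id := Finset.le_sup (f := id) hiS
          omega
        · have := hΔm i i' hΔi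
          omega
    refine ⟨θ₀, Δ₀, cost, hSD, fun n _ _ => le_rfl, fun d' w' P₀ μ hfv h => ?_⟩
    -- finish: one multiplexor contracting the fresh slots `m + S` into `j'`
    have hinj : Function.Injective (fun i : ℕ => m + i) := fun a b h => by simpa using h
    have hmemS' : ∀ i', i' ∈ S.image (fun i => m + i) ↔ ∃ i ∈ S, i' = m + i := fun i' => by
      simp only [Finset.mem_image]
      constructor
      · rintro ⟨i, hi, rfl⟩; exact ⟨i, hi, rfl⟩
      · rintro ⟨i, hi, rfl⟩; exact ⟨i, hi, rfl⟩
    refine MTyping.mpx (σ := σ) (S.image fun i => m + i) j' h ?_ ?_ ?_ ?_ ?_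
    · intro i' hi'
      obtain ⟨i, hi, rfl⟩ := (hmemS' i').1 hi'
      have : Δ₀ i (m + i) ≠ none := by rw [hΔ₀S i hi]; simp
      rw [Ctx.iUnion_apply hSD.disj this, hΔ₀S i hi]
      simp
    · refine Ctx.iUnion_eq_none fun i => ?_
      by_contra h
      rcases hsupp i j' h with ⟨-, he⟩ | ⟨-, hij, hΔi⟩
      · omega
      · exact hΔi (hS.disj j i j' (Ne.symm hij) (by rw [hsing.1]; simp))
    · rw [Finset.card_image_of_injective _ hinj]; exact hr
    · -- the context
      funext i'
      by_cases hiS' : i' ∈ S.image (fun i => m + i)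
      · obtain ⟨i, hi, rfl⟩ := (hmemS' i').1 hiS'
        simp only [Ctx.mpx, hiS', if_true]
        exact Ctx.iUnion_eq_none fun i₂ => hm₀ i₂ _ (by omega)
      · by_cases hij' : i' = j'
        · subst hij'
          simp only [Ctx.mpx, hiS', if_false, if_true]
          rw [Ctx.iUnion_apply hS.disj (i := j) (by rw [hsing.1]; simp), hsing.1]
        · simp only [Ctx.mpx, hiS', if_false, hij']
          by_cases hex : ∃ i, Δ i i' ≠ none
          · obtain ⟨i, hi⟩ := hex
            have hiS : i ∉ S := fun hiS => hi (hΔS i hiS i')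
            have hij : i ≠ j := by
              rintro rfl
              exact hij' (by
                by_contra hne
                exact hi (hsing.2 i' hne))
            have h0 : Δ₀ i i' ≠ none := by rwa [hΔ₀of i hiS hij]
            rw [Ctx.iUnion_apply hS.disj hi, Ctx.iUnion_apply hSD.disj h0, hΔ₀of i hiS hij]
          · have h0 : ∀ i, Δ i i' = none := fun i => by
              by_contra hne; exact hex ⟨i, hne⟩
            rw [Ctx.iUnion_eq_none h0]
            symm
            refine Ctx.iUnion_eq_none fun i => ?_
            by_contra hne
            rcases hsupp i i' hne with ⟨hiS, rfl⟩ | ⟨hiS, hij, hΔi⟩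
            · exact hiS' ((hmemS' _).2 ⟨i, hiS, rfl⟩)
            · exact hΔi (h0 i)
    · -- the subject
      rw [Term.substp_rename, Term.rename_substp]
      refine Term.substp_congr_freeIn P₀ fun i hfi => ?_
      have hΘ₀i := hfv i hfi
      simp only [Function.comp_apply, mpxRen]
      by_cases hiS : i ∈ S
      · have hm' : m + i ∈ S.image (fun i => m + i) := (hmemS' _).2 ⟨i, hiS, rfl⟩
        rw [if_pos hiS, hθj, hθ₀S i hiS]
        simp [Term.rename, mpxRen, hm']
      · obtain ⟨hΘi, hij⟩ := hfree₀ i hΘ₀i hiS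
        rw [if_neg hiS, hθ₀of i hiS]
        symm
        refine Term.rename_eq_self_of_freeIn (θ i) fun i'' hf'' => ?_
        have hΔi : Δ i i'' ≠ none := hS.freeIn_piece (by rw [hΘi]; exact hΘ₀i) hf''
        have : i'' ∉ S.image (fun i => m + i) := fun hmem => by
          obtain ⟨i₂, -, he⟩ := (hmemS' _).1 hmem
          have := hΔm i i'' hΔi
          omega
        simp [mpxRen, this]
  · ----------------------------------------------------------------
    -- Case Sub: `j` receives a box `N : !σ`; substitute renamed-apart copies of its content
    ----------------------------------------------------------------
    have hder2 : MTyping r (cost j) dj (Δ j) (θ j) ⟨σ.bangs + 1, σ.lin⟩ := hder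
    obtain ⟨Γ', d', c', hdd, hcc, hder', hle⟩ := hder2.property1
    have hder'' : MTyping r c' d' Γ' (θ j) σ := hder'
    have hΓ'm : ∀ y, Γ' y ≠ none → y < m := fun y hy => hΔm j y (by
      rw [hle y hy]
      cases h0 : Γ' y with
      | none => exact absurd h0 hy
      | some τ => simp)
    -- the copy renamings
    let ρ : ℕ → ℕ → ℕ := fun x y => m * (x + 1) + y
    have hρ : ∀ x y, ρ x y = m * (x + 1) + y := fun x y => rfl
    have hρinj : ∀ x, Function.Injective (ρ x) := fun x a b h => by
      simpa [hρ] using h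
    have hρm : ∀ x y, m ≤ ρ x y := fun x y => by
      have : m * 1 ≤ m * (x + 1) := Nat.mul_le_mul_left _ (by omega)
      rw [hρ]; omega
    have hρblock : ∀ x₁ x₂ y₁ y₂, y₁ < m → y₂ < m → ρ x₁ y₁ = ρ x₂ y₂ → x₁ = x₂ := by
      intro x₁ x₂ y₁ y₂ h₁ h₂ he
      have e := congrArg (· / m) he
      simp only [hρ, copy_div hm h₁, copy_div hm h₂] at e
      omega
    let θ₀ : ℕ → Term := fun i => if i ∈ S then (θ j).rename (ρ i) else θ i
    let Δ₀ : ℕ → Ctx := fun i =>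
      if i ∈ S then Γ'.image (ρ i) else if i = j then Ctx.empty else Δ i
    let cost₀ : ℕ → ℕ := fun i => if i ∈ S then c' else if i = j then 0 else cost i
    have hΔ₀S : ∀ i ∈ S, Δ₀ i = Γ'.image (ρ i) := fun i hi => by simp [Δ₀, hi]
    have hΔ₀j : Δ₀ j = Ctx.empty := by simp [Δ₀, hjS]
    have hΔ₀of : ∀ i, i ∉ S → i ≠ j → Δ₀ i = Δ i := fun i hi hij => by simp [Δ₀, hi, hij]
    have hθ₀S : ∀ i ∈ S, θ₀ i = (θ j).rename (ρ i) := fun i hi => by simp [θ₀, hi]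
    have hθ₀of : ∀ i, i ∉ S → θ₀ i = θ i := fun i hi => by simp [θ₀, hi]
    have hcost₀S : ∀ i ∈ S, cost₀ i = c' := fun i hi => by simp [cost₀, hi]
    have hcost₀j : cost₀ j = 0 := by simp [cost₀, hjS]
    have hcost₀of : ∀ i, i ∉ S → i ≠ j → cost₀ i = cost i := fun i hi hij => by
      simp [cost₀, hi, hij]
    have hinjOn : ∀ x, Γ'.InjOn (ρ x) := fun x i₁ i₂ _ _ he => hρinj x he
    -- supports of the new pieces
    have hsupp : ∀ i i', Δ₀ i i' ≠ none →
        (i ∈ S ∧ ∃ y, Γ' y ≠ none ∧ ρ i y = i') ∨ (i ∉ S ∧ i ≠ j ∧ Δ i i' ≠ none) := by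
      intro i i' h
      by_cases hiS : i ∈ S
      · rw [hΔ₀S i hiS] at h
        exact Or.inl ⟨hiS, Ctx.exists_of_image_ne_none h⟩
      · by_cases hij : i = j
        · subst hij; rw [hΔ₀j] at h; exact absurd rfl h
        · rw [hΔ₀of i hiS hij] at h
          exact Or.inr ⟨hiS, hij, h⟩
    have hSD : SubstData r D Θ₀ θ₀ Δ₀ cost₀ := by
      refine ⟨fun i τ hτ => ?_, fun i hi => ?_, fun i₁ i₂ i' hne h₁ => ?_, ?_⟩
      · by_cases hiS : i ∈ S
        · rw [hSσ i hiS] at hτ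
          cases hτ
          refine Or.inr ⟨d', by omega, ?_⟩
          rw [hcost₀S i hiS, hΔ₀S i hiS, hθ₀S i hiS]
          exact hder''.rename_ctx (hinjOn i)
        · obtain ⟨hΘi, hij⟩ := hfree₀ i (by rw [hτ]; simp) hiS
          rw [hθ₀of i hiS, hΔ₀of i hiS hij, hcost₀of i hiS hij]
          exact hS.slot i τ (by rw [hΘi, hτ])
      · have hiS : i ∉ S := fun h => by rw [hSσ i h] at hi; cases hi
        by_cases hij : i = j
        · subst hij
          exact ⟨fun i' => by rw [hΔ₀j]; rfl, hcost₀j⟩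
        · rw [hΔ₀of i hiS hij, hcost₀of i hiS hij]
          exact hS.off i (by rw [hΘof i hiS hij, hi])
      · rcases hsupp i₁ i' h₁ with ⟨h₁S, y₁, hy₁, rfl⟩ | ⟨h₁S, h₁j, hΔ₁⟩
        · by_cases h₂S : i₂ ∈ S
          · rw [hΔ₀S i₂ h₂S]
            refine Ctx.image_eq_none fun y₂ hy₂ he => hne ?_
            exact (hρblock i₂ i₁ y₂ y₁ (hΓ'm y₂ hy₂) (hΓ'm y₁ hy₁) he).symm
          · by_cases h₂j : i₂ = j
            · subst h₂j; rw [hΔ₀j]; rfl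
            · rw [hΔ₀of i₂ h₂S h₂j]
              exact hm₀ i₂ _ (by have := hρm i₁ y₁; omega)
        · have hi'm := hΔm i₁ i' hΔ₁
          by_cases h₂S : i₂ ∈ S
          · rw [hΔ₀S i₂ h₂S]
            refine Ctx.image_eq_none fun y₂ _ he => ?_
            have := hρm i₂ y₂
            omega
          · by_cases h₂j : i₂ = j
            · subst h₂j; rw [hΔ₀j]; rfl
            · rw [hΔ₀of i₂ h₂S h₂j]
              exact hS.disj i₁ i₂ i' hne hΔ₁
      · refine ⟨m * (S.sup id + 2), fun i i' hi' => ?_⟩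
        by_contra h
        rcases hsupp i i' h with ⟨hiS, y, hy, rfl⟩ | ⟨-, -, hΔi⟩
        · have h1 : i ≤ S.sup id := Finset.le_sup (f := id) hiS
          have h2 := hΓ'm y hy
          have h3 : m * (i + 1) + y < m * (i + 2) := by
            have : m * (i + 2) = m * (i + 1) + m := by ring
            omega
          have h4 : m * (i + 2) ≤ m * (S.sup id + 2) := Nat.mul_le_mul_left _ (by omega)
          rw [hρ] at hi'
          omega
        · have := hΔm i i' hΔi
          have : m ≤ m * (S.sup id + 2) := Nat.le_mul_of_pos_right _ (by omega)
          omega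
    refine ⟨θ₀, Δ₀, cost₀, hSD, fun n hn hn₀ => ?_, fun d₁ w₁ P₀ μ hfv h => ?_⟩
    · -- the total cost: `|S| · c' ≤ r · c' = cost j`
      have hjn : j < n := by
        by_contra hc
        have := hn j (by omega)
        rw [hΘj] at this
        cases this
      have hSn : S ⊆ Finset.range n := fun i hi => by
        by_contra hc
        have := hn₀ i (by simpa using hc)
        rw [hSσ i hi] at this
        cases this
      have hpt : ∀ i, cost₀ i + (if i = j then cost j else 0) =
          cost i + (if i ∈ S then c' else 0) := by
        intro i
        by_cases hiS : i ∈ S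
        · have hij : i ≠ j := fun e => hjS (e ▸ hiS)
          simp [hcost₀S i hiS, hcostS i hiS, hiS, hij]
        · by_cases hij : i = j
          · subst hij; simp [hcost₀j, hjS]
          · simp [hcost₀of i hiS hij, hiS, hij]
      have hsum := Finset.sum_congr rfl fun i (_ : i ∈ Finset.range n) => hpt i
      rw [Finset.sum_add_distrib, Finset.sum_add_distrib, Finset.sum_ite_eq' (Finset.range n) j,
        if_pos (Finset.mem_range.2 hjn), Finset.sum_ite_mem, Finset.inter_eq_right.2 hSn,
        Finset.sum_const, smul_eq_mul] at hsum
      have hsum' : (Finset.range n).sum cost₀ + cost j = (Finset.range n).sum cost + S.card * c' :=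
        hsum
      have hSc : S.card * c' ≤ cost j := by
        rw [hcc]
        exact Nat.mul_le_mul_right _ hr
      omega
    · -- finish: merge the copies of every `y ∈ supp Γ'`, then restore the rest of `Δ j`
      have hcopy : ∀ x ∈ S, ∀ y, Γ' y ≠ none → Ctx.iUnion Δ₀ (m * (x + 1) + y) = Γ' y := by
        intro x hx y hy
        have himg : (Γ'.image (ρ x)) (ρ x y) = Γ' y := Ctx.image_apply (hinjOn x) hy
        have h0 : Δ₀ x (ρ x y) ≠ none := by rw [hΔ₀S x hx, himg]; exact hy
        rw [← hρ, Ctx.iUnion_apply hSD.disj h0, hΔ₀S x hx, himg]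
      have htarget : ∀ y, Γ' y ≠ none → Ctx.iUnion Δ₀ y = none := by
        intro y hy
        have hym := hΓ'm y hy
        refine Ctx.iUnion_eq_none fun i => ?_
        by_contra h
        rcases hsupp i y h with ⟨hiS, y', -, he⟩ | ⟨hiS, hij, hΔi⟩
        · have := hρm i y'; omega
        · refine hΔi (hS.disj j i y (Ne.symm hij) ?_)
          rw [hle y hy]
          cases h0 : Γ' y with
          | none => exact absurd h0 hy
          | some τ => simp
      have h₁ := MTyping.mergeCopies hm hr hΓ'm hcopy htarget h
      -- restore the remaining assumptions: the merged context is a sub-context of `⋃ Δ`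
      have hle' : ∀ i', mergedCtx m S Γ' (Ctx.iUnion Δ₀) i' ≠ none →
          Ctx.iUnion Δ i' = mergedCtx m S Γ' (Ctx.iUnion Δ₀) i' := by
        intro i' hi'
        simp only [mergedCtx] at hi' ⊢
        by_cases hs : (Γ' i').isSome = true
        · rw [if_pos hs] at hi' ⊢
          have hy : Γ' i' ≠ none := Option.isSome_iff_ne_none.1 hs
          have hΔj : Δ j i' ≠ none := by
            rw [hle i' hy]
            cases h0 : Γ' i' with
            | none => exact absurd h0 hy
            | some τ => simp
          rw [Ctx.iUnion_apply hS.disj hΔj, hle i' hy]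
        · rw [if_neg hs] at hi' ⊢
          by_cases hcp : IsCopy m S Γ' i'
          · rw [if_pos hcp] at hi'
            exact absurd rfl hi'
          · rw [if_neg hcp] at hi' ⊢
            obtain ⟨i, hi⟩ := Ctx.exists_of_iUnion_ne_none hi'
            rcases hsupp i i' hi with ⟨hiS, y, hy, he⟩ | ⟨hiS, hij, hΔi⟩
            · exfalso
              refine hcp ⟨by rw [← he]; exact hρm i y, ?_, ?_⟩
              · rw [← he, hρ, copy_div hm (hΓ'm y hy), Nat.add_sub_cancel]; exact hiS
              · rw [← he, hρ, copy_mod (hΓ'm y hy)]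
                exact Option.isSome_iff_ne_none.2 hy
            · rw [Ctx.iUnion_apply hS.disj hΔi, Ctx.iUnion_apply hSD.disj hi, hΔ₀of i hiS hij]
      have h₂ := h₁.extend hle' (Ctx.iUnion_boundedBy (m := m) fun i i' hi' => hm₀ i i' (by omega))
      -- identify the subject
      have hsubj : (P₀.substp θ₀).rename (mergeRen m S Γ') = (P₀.rename (mpxRen S j)).substp θ := by
        rw [Term.rename_substp, Term.substp_rename]
        refine Term.substp_congr_freeIn P₀ fun i hfi => ?_
        have hΘ₀i := hfv i hfi
        simp only [Function.comp_apply, mpxRen]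
        by_cases hiS : i ∈ S
        · rw [if_pos hiS, hθ₀S i hiS, Term.rename_rename]
          refine Term.rename_eq_self_of_freeIn (θ j) fun y hy => ?_
          have hΓy : Γ' y ≠ none := hder''.isSome_of_freeIn hy
          have hym := hΓ'm y hΓy
          have hcp : IsCopy m S Γ' (ρ i y) := by
            refine ⟨hρm i y, ?_, ?_⟩
            · rw [hρ, copy_div hm hym, Nat.add_sub_cancel]; exact hiS
            · rw [hρ, copy_mod hym]; exact Option.isSome_iff_ne_none.2 hΓy
          simp only [Function.comp_apply, mergeRen, hcp, if_true]
          rw [hρ, copy_mod hym]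
        · obtain ⟨hΘi, hij⟩ := hfree₀ i hΘ₀i hiS
          rw [if_neg hiS, hθ₀of i hiS]
          refine Term.rename_eq_self_of_freeIn (θ i) fun i'' hf'' => ?_
          have hΔi : Δ i i'' ≠ none := hS.freeIn_piece (by rw [hΘi]; exact hΘ₀i) hf''
          have hlt := hΔm i i'' hΔi
          have hcp : ¬IsCopy m S Γ' i'' := fun ⟨h1, _, _⟩ => absurd h1 (by omega)
          simp [mergeRen, hcp]
      rw [← hsubj]
      exact h₂

end SubstData

end STA

end Literature.Computability.ImplicitComplexity
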